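import Summits.QuantumAdvantage.QuantumAdvantage.Theorems.LinnikCubicClassGroupsDegreeOnePrimesEscapeQuarticA4Closure
import Summits.QuantumAdvantage.QuantumAdvantage.Theorems.LinnikCubicClassGroupsDegreeOnePrimesEscapeQuinticA5Group
import Summits.QuantumAdvantage.QuantumAdvantage.Theorems.LinnikCubicClassGroupsDegreeOnePrimesEscapeOneSidedFrobenius
import Summits.QuantumAdvantage.QuantumAdvantage.Theorems.LinnikCubicClassGroupsDegreeOnePrimesEscapeSymmetricClosure
import HarnessLib

/-!
# Every `A₄`-quartic field has a prime of splitting type `(1,3)` below `|d_K|^L`, unconditionally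

Topic `Summits/QuantumAdvantage/QuantumAdvantage/Theorems`, cell B2b-1 (linnik-cubic), PART A (gen 8);
helper toward the crux `DegreeOnePrimesEscape` (stmt-QuantumAdvantage-11543) of route
`LinnikCubicClassGroups`.  HONEST FRAMING: the value of this file is a THEOREM (kernel-checked, GRH-free,
Siegel-free, no hypothesis) — NOT summit progress.

**Theorem** (`exists_splittingType_one_three_le_of_quartic_A4`).  There is `L > 0` such that: if `K`
is a quartic number field and `N` a Galois number field of degree `12` generated by the embedded copies
of `K` (so `Gal(N/ℚ) ≅ A₄` — `K` has no inert primes at all), then some prime `p ≤ |d_K|^L`, `p ∤ d_K`,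
has `p𝓞_K = 𝔭₁𝔭₃` (residue degrees `1, 3`; Frobenius a 3-cycle; density `2/3`).  One-sided data in `A₄`:
`3·𝟙[3-cycle] ≥ 3 − Ind_{V₄}^{A₄} 1`, i.e. `12 ≤ #{q ∈ A₄ : q y q⁻¹ ∈ V₄} + 12·𝟙[#Fix(y) = 1]`
(`quarticA4_pointwise`, `decide`); the principle `exists_frobenius_mem_of_oneSided` needs only the
UPPER bound for the cubic resolvent field `N^{V₄}` and the prime number theorem; Perlis' dictionary with
the `A₄`-count `#{q ∈ A₄ : (q σ q⁻¹)(0) = 0} = 3·#Fix(σ)` (half of the `S₄`-count,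
`card_filter_even_mul_two`) gives the splitting type.  Placement: known with explicit exponent
(LMO 1979; Cho–Lemke Oliver–Zaman 2025, Thm 4); kernel-checked certification only.

References: J. C. Lagarias, H. L. Montgomery, A. M. Odlyzko, Invent. Math. 54 (1979)
[LagariasMontgomeryOdlyzko1979]; R. Perlis, J. Number Theory 9 (1977) [Perlis1977].
-/

noncomputable section

open scoped NumberField nonZeroDivisors
open Finset Real Ideal NumberField Equiv
open Literature.NumberTheory.NumberFields Literature.NumberTheory.LFunctions
  Literature.NumberTheory.LFunctions.NumberField

namespace Summit.QuantumAdvantage.QuantumAdvantage.Theorems.DegreeOnePrimesEscape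

/-! ### The computation in `A₄ ⊂ Perm (Fin 4)` (by `decide`) -/

set_option maxRecDepth 8000 in
/-- The Klein four-group `V₄ ◁ S₄`: contains `1`, closed under products and inverses, normalised by
`(1 2)`; `#{q even : q ∈ V₄} = 4`, `#{q even : q 0 = 0} = 3`, `#{q : q 0 = 0} = 6`; `(1 2)` is odd and
fixes `0`; and the one-sided inequality `12 ≤ #{q even : q y q⁻¹ ∈ V₄} + 12·𝟙[#Fix(y) = 1]` together
with `#Fix(y²) = 1` for even `y` with one fixed point. (`decide`) -/
theorem quarticA4_pointwise :
    (1 : Perm (Fin 4)) ∈ ({1, Equiv.swap (0 : Fin 4) 1 * Equiv.swap (2 : Fin 4) 3,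
        Equiv.swap (0 : Fin 4) 2 * Equiv.swap (1 : Fin 4) 3,
        Equiv.swap (0 : Fin 4) 3 * Equiv.swap (1 : Fin 4) 2} : Finset (Perm (Fin 4))) ∧
    (∀ a ∈ ({1, Equiv.swap (0 : Fin 4) 1 * Equiv.swap (2 : Fin 4) 3,
        Equiv.swap (0 : Fin 4) 2 * Equiv.swap (1 : Fin 4) 3,
        Equiv.swap (0 : Fin 4) 3 * Equiv.swap (1 : Fin 4) 2} : Finset (Perm (Fin 4))),
      ∀ b ∈ ({1, Equiv.swap (0 : Fin 4) 1 * Equiv.swap (2 : Fin 4) 3,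
        Equiv.swap (0 : Fin 4) 2 * Equiv.swap (1 : Fin 4) 3,
        Equiv.swap (0 : Fin 4) 3 * Equiv.swap (1 : Fin 4) 2} : Finset (Perm (Fin 4))),
      a * b ∈ ({1, Equiv.swap (0 : Fin 4) 1 * Equiv.swap (2 : Fin 4) 3,
        Equiv.swap (0 : Fin 4) 2 * Equiv.swap (1 : Fin 4) 3,
        Equiv.swap (0 : Fin 4) 3 * Equiv.swap (1 : Fin 4) 2} : Finset (Perm (Fin 4)))) ∧
    (∀ a ∈ ({1, Equiv.swap (0 : Fin 4) 1 * Equiv.swap (2 : Fin 4) 3,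
        Equiv.swap (0 : Fin 4) 2 * Equiv.swap (1 : Fin 4) 3,
        Equiv.swap (0 : Fin 4) 3 * Equiv.swap (1 : Fin 4) 2} : Finset (Perm (Fin 4))),
      a⁻¹ ∈ ({1, Equiv.swap (0 : Fin 4) 1 * Equiv.swap (2 : Fin 4) 3,
        Equiv.swap (0 : Fin 4) 2 * Equiv.swap (1 : Fin 4) 3,
        Equiv.swap (0 : Fin 4) 3 * Equiv.swap (1 : Fin 4) 2} : Finset (Perm (Fin 4)))) ∧
    (Finset.univ.filter fun q : Perm (Fin 4) => Perm.sign q = 1 ∧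
      q ∈ ({1, Equiv.swap (0 : Fin 4) 1 * Equiv.swap (2 : Fin 4) 3,
        Equiv.swap (0 : Fin 4) 2 * Equiv.swap (1 : Fin 4) 3,
        Equiv.swap (0 : Fin 4) 3 * Equiv.swap (1 : Fin 4) 2} : Finset (Perm (Fin 4)))).card = 4 ∧
    (Finset.univ.filter fun q : Perm (Fin 4) => Perm.sign q = 1 ∧ q 0 = 0).card = 3 ∧
    (Finset.univ.filter fun q : Perm (Fin 4) => q 0 = 0).card = 6 ∧
    Perm.sign (Equiv.swap (1 : Fin 4) 2) = -1 ∧ (Equiv.swap (1 : Fin 4) 2) 0 = 0 ∧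
    (∀ y : Perm (Fin 4), Perm.sign y = 1 →
      12 ≤ (Finset.univ.filter fun q : Perm (Fin 4) => Perm.sign q = 1 ∧
        q * y * q⁻¹ ∈ ({1, Equiv.swap (0 : Fin 4) 1 * Equiv.swap (2 : Fin 4) 3,
          Equiv.swap (0 : Fin 4) 2 * Equiv.swap (1 : Fin 4) 3,
          Equiv.swap (0 : Fin 4) 3 * Equiv.swap (1 : Fin 4) 2} : Finset (Perm (Fin 4)))).card +
        (if (Finset.univ.filter fun i : Fin 4 => y i = i).card = 1 then 12 else 0)) ∧
    (∀ y : Perm (Fin 4), Perm.sign y = 1 → (Finset.univ.filter fun i : Fin 4 => y i = i).card = 1 →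
      (Finset.univ.filter fun i : Fin 4 => (y ^ 2) i = i).card = 1) := by
  refine ⟨by decide, by decide, by decide, by decide, by decide, by decide, by decide, by decide,
    by decide, by decide⟩

/-! ### Splitting type `(1,3)` from the fixed-point data -/

/-- For a quartic field and `p ∤ d_K`: if exactly one prime above `p` has residue degree `1` and none
has residue degree `2` (`Σ_{f ∣ 2} f = 1`) then `T_K(p) = {1, 3}`. -/
theorem splittingType_eq_one_three {K : Type*} [Field K] [NumberField K] (h4 : Module.finrank ℚ K = 4)
    {p : ℕ} (hp : p.Prime) (hd : ¬ (p : ℤ) ∣ NumberField.discr K)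
    (h1 : ((splittingType K p).filter (· ∣ 1)).sum = 1)
    (h2 : ((splittingType K p).filter (· ∣ 2)).sum = 1) :
    splittingType K p = {1, 3} := by
  classical
  set T := splittingType K p with hT
  have hsum : T.sum = 4 := by rw [hT, sum_splittingType_eq_finrank hp hd, h4]
  have hpos : ∀ f ∈ T, 0 < f := fun f hf => splittingType_pos hp hf
  have hfilt1 : T.filter (· ∣ 1) = T.filter (· = 1) :=
    Multiset.filter_congr fun f _ => by simp [Nat.dvd_one]
  have hcount : T.count 1 = 1 := by
    rw [hfilt1, Multiset.filter_eq', Multiset.sum_replicate, smul_eq_mul, mul_one] at h1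
    exact h1
  have hno2 : (2 : ℕ) ∉ T := fun h => by
    have hmem : 2 ∈ T.filter (· ∣ 2) := Multiset.mem_filter.mpr ⟨h, dvd_refl 2⟩
    have := Multiset.le_sum_of_mem hmem
    omega
  set T' := T.filter (· ≠ 1) with hT'
  have hdecomp : T = {1} + T' := by
    have h := (Multiset.filter_add_not (· = 1) T).symm
    rw [Multiset.filter_eq', hcount] at h
    exact h
  have hT'sum : T'.sum = 3 := by
    have := congrArg Multiset.sum hdecomp
    rw [Multiset.sum_add, Multiset.sum_singleton, hsum] at this
    omega
  have hge3 : ∀ f ∈ T', 3 ≤ f := by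
    intro f hf
    rw [hT', Multiset.mem_filter] at hf
    have h0 := hpos f hf.1
    have h2' : f ≠ 2 := fun h => hno2 (h ▸ hf.1)
    omega
  have hcard : Multiset.card T' = 1 := by
    have hle : 3 * Multiset.card T' ≤ T'.sum := by
      have := Multiset.card_nsmul_le_sum hge3
      simpa [smul_eq_mul, mul_comm] using this
    rcases Nat.lt_or_ge (Multiset.card T') 2 with h | h
    · interval_cases hc : Multiset.card T'
      · rw [Multiset.card_eq_zero] at hc
        rw [hc, Multiset.sum_zero] at hT'sum
        exact absurd hT'sum (by norm_num)
      · rfl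
    · omega
  obtain ⟨a, ha⟩ := Multiset.card_eq_one.mp hcard
  have ha3 : a = 3 := by rw [ha, Multiset.sum_singleton] at hT'sum; exact hT'sum
  rw [hdecomp, ha, ha3, Multiset.singleton_add]
  rfl

/-! ### The theorem -/

set_option maxHeartbeats 1600000 in
/-- **A prime of splitting type `(1,3)` in every `A₄`-quartic field, unconditionally.** See the module
docstring. [cite: LagariasMontgomeryOdlyzko1979, Theorem 1.1] -/
theorem exists_splittingType_one_three_le_of_quartic_A4 :
    ∃ L : ℝ, 0 < L ∧ ∀ (K : Type) [Field K] [NumberField K], Module.finrank ℚ K = 4 →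
      ∀ (N : Type) [Field N] [NumberField N] [IsGalois ℚ N], Module.finrank ℚ N = 12 →
        (⨆ f : K →ₐ[ℚ] N, f.fieldRange) = ⊤ →
        ∃ p : ℕ, p.Prime ∧ (p : ℝ) ≤ ((NumberField.discr K).natAbs : ℝ) ^ L ∧
          ¬ ((p : ℤ) ∣ NumberField.discr K) ∧ splittingType K p = {1, 3} := by
  classical
  obtain ⟨L₀, hL₀, hgen⟩ := exists_frobenius_mem_of_oneSided 12 1 3 3 (by norm_num) (by norm_num)
  refine ⟨12 * L₀, by positivity, fun K _ _ hK N _ _ _ hN hsup => ?_⟩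
  obtain ⟨K', e, ψ, hinj, hrange, hstab, hdN⟩ := quarticA4Closure K hK N hN hsup
  obtain ⟨hV1, hVmul, hVinv, hV4, hA3, hS6, hu, hu0, hpt0, hfix2⟩ := quarticA4_pointwise
  -- the Klein four-group pulled back, and the stabiliser
  set V : Finset (Perm (Fin 4)) := ({1, Equiv.swap (0 : Fin 4) 1 * Equiv.swap (2 : Fin 4) 3,
    Equiv.swap (0 : Fin 4) 2 * Equiv.swap (1 : Fin 4) 3,
    Equiv.swap (0 : Fin 4) 3 * Equiv.swap (1 : Fin 4) 2} : Finset (Perm (Fin 4))) with hVdef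
  let Vsub : Subgroup (Perm (Fin 4)) :=
    { carrier := {σ | σ ∈ V}
      mul_mem' := fun {a} {b} ha hb => hVmul a ha b hb
      one_mem' := hV1
      inv_mem' := fun {a} ha => hVinv a ha }
  let V' : Subgroup (N ≃ₐ[ℚ] N) := Vsub.comap ψ
  have hV' : ∀ g, g ∈ V' ↔ ψ g ∈ V := fun g => Iff.rfl
  set S' := K'.fixingSubgroup with hS'def
  have hcardV' : Nat.card V' = 4 := by
    rw [natCard_subgroup_eq_card_filter_even ψ hinj hrange V' (· ∈ V) hV', hV4]
  have hcardS' : Nat.card S' = 3 := by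
    rw [natCard_subgroup_eq_card_filter_even ψ hinj hrange S' (fun q => q 0 = 0) hstab, hA3]
  have hG : Nat.card (N ≃ₐ[ℚ] N) = 12 := by rw [IsGalois.card_aut_eq_finrank, hN]
  -- the stabiliser test is invariant under the odd permutation `u = (1 2)` fixing `0`
  set u : Perm (Fin 4) := Equiv.swap (1 : Fin 4) 2 with hudef
  have hu0' : u⁻¹ 0 = 0 := by rw [Equiv.Perm.inv_eq_iff_eq]; exact hu0.symm
  have hQS : ∀ (y q : Perm (Fin 4)), ((u * q) * y * (u * q)⁻¹) 0 = 0 ↔ (q * y * q⁻¹) 0 = 0 := by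
    intro y q
    have : (u * q) * y * (u * q)⁻¹ = u * (q * y * q⁻¹) * u⁻¹ := by group
    rw [this, Equiv.Perm.mul_apply, Equiv.Perm.mul_apply, hu0', ← hu0, (Equiv.injective u).eq_iff, hu0]
  have hhalfS : ∀ y : Perm (Fin 4),
      2 * (Finset.univ.filter fun q : Perm (Fin 4) => Perm.sign q = 1 ∧ (q * y * q⁻¹) 0 = 0).card =
        (Finset.univ.filter fun q : Perm (Fin 4) => (q * y * q⁻¹) 0 = 0).card := fun y =>
    card_filter_even_mul_two (fun q => (q * y * q⁻¹) 0 = 0) u hu (fun q => hQS y q)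
  -- the one-sided data in `G`: one subgroup `V'`, `f₁ = t = 3`
  let H : Fin 1 → Subgroup (N ≃ₐ[ℚ] N) := fun _ => V'
  have hH : ∀ i, H i ≠ ⊤ := by
    intro i h
    have : Nat.card V' = Nat.card (⊤ : Subgroup (N ≃ₐ[ℚ] N)) := by
      show Nat.card (H i) = _; rw [h]
    rw [hcardV', Subgroup.card_top, hG] at this
    omega
  obtain ⟨p, hp, hpx, hpN, Q, hQmax, hQover, φ, hφ, hI, hφC⟩ :=
    hgen N hN H {x : N ≃ₐ[ℚ] N | (Finset.univ.filter fun i : Fin 4 => (ψ x) i = i).card = 1} hH (by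
      intro x
      have hsx : Perm.sign (ψ x) = 1 := (hrange _).mp ⟨x, rfl⟩
      have key := hpt0 (ψ x) hsx
      rw [Finset.univ_unique, Finset.sum_singleton]
      show ((3 : ℕ) : ℝ) ≤ (Nat.card {g : N ≃ₐ[ℚ] N // g * x * g⁻¹ ∈ V'} : ℝ) / Nat.card V' + _
      rw [hcardV', natCard_conj_eq_card_filter_even ψ hinj hrange V' (· ∈ V) hV']
      set a := (Finset.univ.filter fun q : Perm (Fin 4) =>
        Perm.sign q = 1 ∧ q * ψ x * q⁻¹ ∈ V).card
      by_cases hfx : (Finset.univ.filter fun i : Fin 4 => (ψ x) i = i).card = 1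
      · rw [if_pos hfx] at key
        have hmem : x ∈ ({x : N ≃ₐ[ℚ] N |
            (Finset.univ.filter fun i : Fin 4 => (ψ x) i = i).card = 1} : Set (N ≃ₐ[ℚ] N)) := hfx
        rw [if_pos hmem]
        have hk : (12 : ℝ) ≤ (a : ℕ) + 12 := by exact_mod_cast key
        push_cast at hk ⊢
        linarith
      · rw [if_neg hfx, add_zero] at key
        have hmem : x ∉ ({x : N ≃ₐ[ℚ] N |
            (Finset.univ.filter fun i : Fin 4 => (ψ x) i = i).card = 1} : Set (N ≃ₐ[ℚ] N)) := hfx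
        rw [if_neg hmem]
        have hk : (12 : ℝ) ≤ (a : ℕ) := by exact_mod_cast key
        push_cast at hk ⊢
        linarith)
  have hφC' : (Finset.univ.filter fun i : Fin 4 => (ψ φ) i = i).card = 1 := hφC
  -- sizes
  set d : ℝ := ((NumberField.discr K).natAbs : ℝ) with hd
  have hd3 : (3 : ℝ) ≤ d := three_le_natAbs_discr_real K (by rw [hK]; norm_num)
  have hd1 : (1 : ℝ) ≤ d := by linarith
  have hpx' : (p : ℝ) ≤ d ^ ((12 : ℝ) * L₀) := by
    have hdNR : ((NumberField.discr N).natAbs : ℝ) ≤ d ^ (12 : ℝ) := by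
      rw [show (12 : ℝ) = ((12 : ℕ) : ℝ) by norm_num, Real.rpow_natCast, hd]; exact_mod_cast hdN
    calc (p : ℝ) ≤ ((NumberField.discr N).natAbs : ℝ) ^ L₀ := hpx
      _ ≤ (d ^ (12 : ℝ)) ^ L₀ := Real.rpow_le_rpow (Nat.cast_nonneg _) hdNR hL₀.le
      _ = d ^ ((12 : ℝ) * L₀) := by rw [← Real.rpow_mul (by linarith)]
  -- `p ∤ d_K`
  have hK' : Module.finrank ℚ K' = 4 := by rw [← e.toLinearEquiv.finrank_eq, hK]
  have hdisc' : NumberField.discr K' = NumberField.discr K :=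
    (NumberField.discr_eq_discr_of_algEquiv K e).symm
  have hdvd : ¬ ((p : ℤ) ∣ NumberField.discr K) := fun h =>
    hpN (h.trans (hdisc' ▸ NumberField.discr_dvd_discr K' N))
  refine ⟨p, hp, hpx', hdvd, ?_⟩
  -- the dictionary: `3 · Σ_{f ∣ m} f = #{q even : (q σ^m q⁻¹) 0 = 0} = 3 · #Fix(σ^m)`
  have hsφ : Perm.sign (ψ φ) = 1 := (hrange _).mp ⟨φ, rfl⟩
  have hdict : ∀ m : ℕ, ((splittingType K p).filter (· ∣ m)).sum =
      (Finset.univ.filter fun i : Fin 4 => ((ψ φ) ^ m) i = i).card := by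
    intro m
    have hk := card_fixingSubgroup_mul_sum_filter_dvd K' hp Q hφ hI m
    rw [hcardS', natCard_conj_eq_card_filter_even ψ hinj hrange S' (fun q => q 0 = 0) hstab, map_pow,
      ← ArithmeticallyEquivalent.of_algEquiv e p hp] at hk
    have h2 := hhalfS ((ψ φ) ^ m)
    rw [card_filter_conj_apply_zero, hS6] at h2
    omega
  refine splittingType_eq_one_three hK hp hdvd ?_ ?_
  · rw [hdict 1, pow_one]; exact hφC'
  · rw [hdict 2]; exact hfix2 (ψ φ) hsφ hφC'

end Summit.QuantumAdvantage.QuantumAdvantage.Theorems.DegreeOnePrimesEscape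

end
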